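import Literature.MathematicalPhysics.QuantumFieldTheory.Balaban1983to89.B1Ineq18ZeroFieldRegion
import Literature.MathematicalPhysics.QuantumFieldTheory.Balaban1983to89.B2Ineq329PrismHolonomy
import Literature.MathematicalPhysics.QuantumFieldTheory.Balaban1983to89.B2Ineq329CovariantAveraging
import Literature.MathematicalPhysics.QuantumFieldTheory.Balaban1983to89.B1Ineq233Upper

/-!
# `Balaban1983to89.B1Ineq18RegularRegion` — T. Bałaban, *Regularity and decay of lattice Green's functions*, Commun. Math.
# Phys. **89** (1983) 571–597 [Balaban1983RegularityDecay], **(1.8) p. 573 AT A REGULAR VECTOR FIELD `A ≠ 0` FOR REGIONS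
# `Ω ⊂ T_ε`** (any union of `k`-fold blocks of the torus, fields supported in `Ω`), for the CONCRETE (Higgs)₂,₃ operator of
# [Balaban1982Higgs1] (2.20) p. 610 with the `k`-FOLD covariant averaging (2.11) along the composite contours (2.2),
# `−Δ^{ε,N}_{A,Ω} + m² + a_k(L^kε)^{−2}P_k(A)` = `HiggsCovariance.covOpK C Ω A m² a k`:
# `γ₀(L^kε)^{−2}‖ψ‖² ≦ ⟨ψ, (−Δ^{ε,N}_{A,Ω} + a_k(L^kε)^{−2}P_k(A))ψ⟩`, `γ₀ = min{2, a_k/4}`, under ONE smallness condition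
# `d²·ε|e|·L^{2k}·δ ≦ 1/3` on the lattice regularity `δ` of `A` on `Ω` — *"for e sufficiently small and for a regular vector field A"*

statement-level skeleton of published theorems with citation tags; proofs where landed; nothing here is a claim about the Yang–Mills mass gap

PDF held: `paper:balaban1983-cmp89-regularity-decay` (journal page = PDF page + 570): p. 573 [PDF 3] (1.8), p. 579 [PDF 9] (proof of
Lemma 2.1, (2.23)–(2.26)), p. 593 [PDF 23] (§5, the blockwise gauge mechanism); `paper:balaban1982-cmp85-higgs23-i` (journal =
PDF + 602): p. 608 [PDF 6] ((2.1)–(2.3), the contours), p. 609 [PDF 7] ((2.11)), p. 610 [PDF 8] ((2.20), (2.23)), p. 611 [PDF 9]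
(Prop. 2.3 (2.33) «γ₀I ≦ …»); OCR `p0009.txt` of [B1] and the ×2 renders of the cell read by this seat.

CITATION HEADER (lean-in-tree rule).  Cell `lit-balaban` (HOME `run/shared/lean/pub/lit-balaban/`), reader/typer seat **r14** gen 14
(unit `lit-balaban-r14`, B1 fold owner; TAKING line HOME/STATUS.md 2026-08-22T07:18:39Z, free-target protocol G.5-34(d)).  SKELETON rows
**B1.Prop2.3** (the INPUT «γ₀I ≦ …» / [13] (1.8) for the operator (2.20) on the printed REGIONS at a REGULAR `A ≠ 0` — the coercivity
constant consumed by the Combes–Thomas pairing bound of the sequel file `B1Cor23RegularRegion`, hence by (2.27)/(2.34)/(2.36) for regions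
at `A ≠ 0`) and **B1.Eq2.20**; xref **B4.Eq1.8** (r01; this file is a MODEL INSTANCE at a regular `A ≠ 0` on the (Higgs)₂,₃ carrier, not
the row's decl of record).  USED BY NAME, never restated: r14 g9 `B1Ineq18ZeroFieldRegion.{blockK_poincare_vec, sum_ite_inside_blockK_le}`
(the zero-field Poincaré inequality on one `k`-fold block, constant `L^{2k}/8`, and the one-block-per-bond count), p23's
`B2Ineq329PrismHolonomy.{abs_multiContourSum_le, abs_sub_le_of_multiStair, blockIter_stair_src, val_steps, sum_steps_le,
multiContourSum_sub, corner_eq_cornerN}` (the composite contour (2.2) as a bond family: every bond starts in `B^k(y)`, length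
`≦ d(L^k − 1)`, step counts), `B2Ineq329ZeroAveraging.{val_blockIter, sitesPerDir_zero_eq, mesh_pow_d, mesh_eq, shiftN_apply_ne,
shiftN_apply_self}`, `B2Ineq329CovariantAveraging.{norm_U_apply_sub_le, U_apply_U}` (`‖U(a)w − w‖ ≦ |εea|‖w‖`, `U(a)U(b) = U(a+b)`),
`B2Restr216Lattice.norm_U_apply`, `B1Ineq233Upper.sum_bond_tgt_sq`, `B1Eq353SupNorm.card_blockK`, the typer's `HiggsLattice` /
`HiggsAveraging` / `HiggsCovariance` / `HiggsCovariancePos.{siteInner_covLaplacianN, siteInner_projPk, siteInner_self_eq}`.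

WHAT IS PRINTED (verbatim).  [13] p. 573 [PDF 3]: *"The operator defining the Green's function (1.6) has a strictly positive lower
bound. More exactly we prove that there exists a positive constant γ₀ such that for e sufficiently small and for a regular vector
field A  −Δ^{η,N}_{A,Ω} + aP_k(A) ≧ γ₀I. (1.8)  The constant γ₀ is independent of the lattice spacing η, as well as of Ω and of
A."*; p. 579 [PDF 9] (proof of Lemma 2.1): *"We can write the configuration A as a sum A₀ + A′, where A₀ is a constant
configuration, e.g. it is a value of A at some point of □, and A′ is a small and regular configuration, i.e. we have
A = A₀ + A′, |A′|, |∂^η_μA′| ≦ c′e^{β−1} (2.23)"* … *"Using the same gauge transformation as in the proof of Lemma 2.4, we reduce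
them to the case A₀ = 0. Now these bounds are consequences of quadratic form considerations."*; p. 593 [PDF 23]: *"we separate the
blocks by Neumann boundary conditions, in each block we decompose A = A₀ + A′ … Next we "gauge away" the constant field"*.
[B1] p. 610 [PDF 8]: *"G^ε_k(Ω, A) = (−Δ^{ε,N}_{A,Ω} + m² + a_k(L^kε)^{−2}P_k(A))^{−1}, P_k(A) = Q_k^*(A)Q_k(A) (2.20)"*; *"let a
configuration A be regular on Ω in the sense that |(∂^η_μA)(x)| ≦ c(e(L^kε))^{β−1}, x ∈ Ω, μ = 1, …, d, (2.23)"*; p. 608 [PDF 6]: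
*"Γ^{(k)}_{y,x} = Γ_{y,x_{k−1}} ∪ Γ_{x_{k−1},x_{k−2}} ∪ … ∪ Γ_{x₁,x}, y ∈ T^{(k)}_{L^kε}, x ∈ B^k(y). (2.2)"*.

DICTIONARY.  `T_ε = HiggsLattice.Site P 0`; `Ω ⊂ T_ε` a union of `k`-fold blocks (`hΩ`: membership depends on `blockIter k` only),
*"functions φ : Ω → R^N"* ↦ `ψ` SUPPORTED IN `Ω`; «A regular on Ω» ((2.23), [13] (1.21)) ↦ the one-step differences of the bond
variables in lattice units, `|A ⟨z + εe_ν, μ⟩ − A ⟨z, μ⟩| ≦ δ` for `z ∈ Ω` (`hreg`; as in r14 g13's `B1Ineq233LowerRegularOnRegion` and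
p23's (II.3.29) files); `η = L^{−k}`-units ↦ `ε`-units: (1.8) reads `γ₀(L^kε)^{−2}‖ψ‖² ≦ ⟨ψ, (−Δ^{ε,N}_{A,Ω} + a_k(L^kε)^{−2}P_k(A))ψ⟩`.
«A = A₀ + A′ in each block, A₀ a value of A at some point» ↦ `refVal A k y ν = A ⟨corner of B^k(y), ν⟩`; the gauge function of the
blockwise-constant part ↦ `gaugeFn A k x = Σ_ν refVal(x_k)_ν · pos_ν(x)` (`pos_ν(x) = x_ν mod L^k`, the position of `x` in its block),
which IS `A₀(Γ^{(k)}_{y,x})` (`multiContourSum_blockConst`); «e sufficiently small» ↦ `d²·ε|e|·L^{2k}·δ ≦ 1/3` (`hsmall`; under (2.23)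
in the rescaled currency `δ = c·e(L^kε)^β/(L^{2k}ε|e|)` this is `c·d²·e(L^kε)^β ≦ 1/3`, §6).

THE MECHANISM (why the gauge, numbers).  The zero-field block Poincaré inequality has constant `L^{2k}/8` (block side `L^k`).  Applied
to the transported field `U(A(Γ^{(k)}_{y,·}))ψ` directly it charges the loop holonomy `≈ ε|e|·L^{2k}δ` of EVERY bond against that
constant: relative error `L^{2k}·(εeL^{2k}δ)²`, not uniform in `k`.  Gauging away the blockwise-constant part first (exact: `P_k` and
the Neumann form are gauge covariant, `Q_k(A)ψ = Q_k(A′)(U(λ)ψ)` with NO phase since `λ` vanishes at the block corner) leaves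
`A′ = A − A₀` with `|A′_b| ≦ d(L^k−1)δ` on the block, which enters TWICE: through `|A′(Γ^{(k)})| ≦ d²(L^k−1)²δ` on the `P_k` side, where
there is no Poincaré factor (relative error `2θ′²`, `θ′ = ε|e|d²(L^k−1)²δ`), and through `|U(A′_b) − U(0)| ≦ ε|e|d(L^k−1)δ = θ″` on the
bond side (relative error `dL^{2k}θ″²/4`) — both `≦ (d²ε|e|L^{2k}δ)²`, uniformly small.  This is exactly the printed «decompose
A = A₀ + A′ … gauge away the constant field … quadratic form considerations».

WHAT THIS FILE PROVES (kernel-checked, zero `sorry`; three plumbing `def`s with bodies `refVal`/`gaugeFn`/`gauged`, no `Prop`-valued fact).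
* §1 step counts: `sum_steps_eq` (`Σ_{i<k} m_{i,ν}(x) = x_ν mod L^k`, EQUALITY form of p23's `sum_steps_le`).
* §2 the block gauge: `refVal`, `gaugeFn`, **`multiContourSum_blockConst`** (`A₀(Γ^{(k)}_{y,x}) = gaugeFn x` for the blockwise-constant
  field `A₀ ⟨z, ν⟩ = refVal(z_k)_ν`), `two_le_sitesPerDir`, `pos_shift_self`, **`gaugeFn_shift`** (`λ(z + εe_μ) − λ(z) = refVal(z_k)_μ` on
  intra-block bonds).
* §3 regularity ⇒ smallness: **`abs_sub_refVal_le`** (`|A ⟨z, ν⟩ − refVal(z_k)_ν| ≦ d(L^k−1)δ` for `z ∈ Ω`, telescoping along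
  `Γ^{(k)}`), **`abs_multiContourSum_sub_gaugeFn_le`** (`|A(Γ^{(k)}_{y,x}) − λ(x)| ≦ (d(L^k−1))²δ`).
* §4 the gauged field `φ = U(λ)ψ`: `norm_gauged`, **`norm_sum_gauged_le`** (`‖Σ_{B^k(y)}φ‖ ≦ ‖Σ_{B^k(y)}U(A(Γ^{(k)}))ψ‖ + θ′Σ‖ψ‖`),
  **`norm_gauged_bond_le`** (`‖φ(b₊) − φ(b₋)‖ ≦ ε‖(D^ε_Aψ)(b)‖ + θ″‖ψ(b₊)‖` on intra-block bonds).
* §5 **`block_estimate`** (one `k`-fold block, abstract `θ′, θ″`: `S ≦ 2L^{−kd}V² + 2θ′²S + (L^{2k}ε²/4)D + (L^{2k}θ″²/4)T`),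
  `sum_blocksK_cov_le_inside`, **`summed_estimate`** (the blocks summed: `‖ψ‖² ≦ 2⟨ψ,P_k(A)ψ⟩ + 2θ′²‖ψ‖² + ((L^kε)²/4)⟨ψ,−Δ_{A,Ω}ψ⟩ +
  (L^{2k}θ″²d/4)‖ψ‖²`), **`budgets`** (`2θ′² ≦ 1/4` and `L^{2k}θ″²d/4 ≦ 1/4` from `d²·ε|e|·L^{2k}·δ ≦ 1/3`),
  **`siteInner_self_le_projPk_add_cov`** (`‖ψ‖² ≦ 4⟨ψ,P_k(A)ψ⟩ + ((L^kε)²/2)⟨ψ, −Δ^{ε,N}_{A,Ω}ψ⟩`), `coercive_arith4`, and **(1.8) AT A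
  REGULAR `A` FOR REGIONS**: **`coercive_covOpK_regular_region`** (`(min{2, a_k/4}(L^kε)^{−2} + m²)‖ψ‖² ≦ ⟨ψ, covOpK C Ω A m² a k ψ⟩`,
  every `k ≦ K`, `a_k ≧ 0`, any `m²`), **`ineq18_regular_region`** (printed massless shape), **`coercive_covOpK_regular_region_uniform`**
  (`1 ≦ k ≦ K`: `γ₀ = min{2, a(1 − L^{−2})/4}`), `gammaReg_pos`, `coercive_covOpK_regular_univ` (`Ω = T_ε`).
* §6 **`coercive_covOpK_of_reg223`** — the printed (2.23) currency of p35's `B1Ineq225RegularTorus` (`(L^kε|e|/e_k)|∂A| ≦ c·e_k^{β−1}/L^k`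
  bond by bond at the sites of `Ω`): (1.8) with the uniform constant holds whenever `d²·c·e_k^β ≦ 1/3` — «for e(L^kε) sufficiently small»
  (any charge `e`, `e = 0` included).
HONEST SCOPE / DIVERGENCE.  (i) `Ω` = any union of `k`-fold blocks of `T_ε` (holes/wrapping allowed; weaker than *"unions of big
blocks"*), regularity asked at the sites of `Ω` only (the difference AT `z ∈ Ω` may involve the bond one step outside `Ω`, as in print);
(ii) `γ₀ = min{2, a_k/4}` is crude (Poincaré constant `L^{2k}/8` halved twice by the two perturbation budgets), not the print's; the
threshold `1/3` is this file's; (iii) METHOD = the printed blockwise gauge + quadratic forms, written as ONE inequality chain (no operator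
expansion (2.24)–(2.26), which print uses for the finer Lemma 2.1); (iv) `k ≦ K` (the `k`-fold blocks do not wrap); (v) nothing here is
summit progress.  Downstream (same seat): the Combes–Thomas pairing bound [13] Cor. 2.3 (2.30) for `G^ε_k(Ω, A)` at a regular `A`.
-/

noncomputable section

open scoped BigOperators InnerProductSpace

namespace Literature.MathematicalPhysics.QuantumFieldTheory.Balaban1983to89.B1Ineq18RegularRegion

open HiggsLattice HiggsAveraging HiggsCovariance HiggsCovariancePos
open HiggsFluctMeasurePos (siteInner_comm siteInner_add_right siteInner_smul_right siteInner_self_pos)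
open B2Ineq329ZeroAveraging (sitesPerDir_zero_eq val_blockIter mesh_pow_d mesh_eq shiftN_apply_ne shiftN_apply_self)
open B2Ineq329PrismHolonomy (abs_multiContourSum_le abs_sub_le_of_multiStair blockIter_stair_src val_steps sum_steps_le
  multiContourSum_sub corner_eq_cornerN val_toFinest)
open B2Ineq329CovariantAveraging (norm_U_apply_sub_le U_apply_U)
open B2Restr216Lattice (cornerN norm_U_apply)
open B1Ineq233Upper (sum_bond_tgt_sq)
open B1Eq353SupNorm (card_blockK)
open B1Ineq18ZeroFieldRegion (blockK_poincare_vec sum_ite_inside_blockK_le)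

variable {P : HiggsLattice.Params} {N : ℕ} {k : ℕ}

/-! ## §1 Step counts of the composite contour: `Σ_{i<k} m_{i,ν}(x) = x_ν mod L^k` -/

section Steps

/-- `L^{i+1}⌊v/L^{i+1}⌋ ≤ Lⁱ⌊v/Lⁱ⌋`. [folklore] -/
private theorem cl_succ_le (v i : ℕ) : v / P.L ^ (i + 1) * P.L ^ (i + 1) ≤ v / P.L ^ i * P.L ^ i := by
  have hLi : 0 < P.L ^ i := pow_pos P.hL i
  have hdvd : P.L ^ i ∣ v / P.L ^ (i + 1) * P.L ^ (i + 1) := Dvd.dvd.mul_left (pow_dvd_pow P.L (Nat.le_succ i)) _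
  calc v / P.L ^ (i + 1) * P.L ^ (i + 1)
      = (v / P.L ^ (i + 1) * P.L ^ (i + 1)) / P.L ^ i * P.L ^ i := (Nat.div_mul_cancel hdvd).symm
    _ ≤ v / P.L ^ i * P.L ^ i := Nat.mul_le_mul_right _ (Nat.div_le_div_right (Nat.div_mul_le_self v _))

/-- **The total number of steps of `Γ^{(k)}_{y,x}` in direction `ν` is the position of `x` in its `k`-block**:
`Σ_{i<k} m_{i,ν}(x) = x_ν − L^k⌊x_ν/L^k⌋ = x_ν mod L^k` (`k ≤ K`; equality form of p23's `sum_steps_le`).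
[cite: Balaban1982Higgs1, (2.2) p.608] -/
theorem sum_steps_eq (hk : k ≤ P.K) (x : HiggsLattice.Site P 0) (ν : Fin P.d) :
    ∑ i ∈ Finset.range k, (((toFinest (blockIter i x)) ν - (toFinest (blockIter (i + 1) x)) ν).val : ℝ)
      = (((x ν).val % P.L ^ k : ℕ) : ℝ) := by
  have e : ∀ i ∈ Finset.range k, (((toFinest (blockIter i x)) ν - (toFinest (blockIter (i + 1) x)) ν).val : ℝ)
      = ((x ν).val / P.L ^ i * P.L ^ i : ℕ) - ((x ν).val / P.L ^ (i + 1) * P.L ^ (i + 1) : ℕ) := by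
    intro i hi
    have hi1 : i + 1 ≤ P.K := by have := Finset.mem_range.1 hi; omega
    rw [val_steps hi1, Nat.cast_sub (cl_succ_le _ _)]
  rw [Finset.sum_congr rfl e, Finset.sum_range_sub' (fun i => (((x ν).val / P.L ^ i * P.L ^ i : ℕ) : ℝ))]
  simp only [pow_zero, Nat.div_one, mul_one]
  rw [sub_eq_iff_eq_add, ← Nat.cast_add, Nat.mod_add_div' (x ν).val (P.L ^ k)]

end Steps

/-! ## §2 The block gauge: reference values at the block corners, the gauge function, `A₀(Γ^{(k)}_{y,x}) = λ(x)` -/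

section Gauge

/-- **«A₀ is a constant configuration, e.g. it is a value of A at some point of □»**: the reference value of the component `ν` of
`A` on the `k`-fold block `B^k(y)` — its value at the block corner `toFinest y`. [cite: Balaban1983RegularityDecay, (2.23) p.579] -/
def refVal (A : HiggsLattice.VecField P 0) (k : ℕ) (y : HiggsLattice.Site P k) (ν : Fin P.d) : ℝ :=
  A ⟨toFinest y, ν⟩

/-- **The gauge function of the blockwise-constant part**: `λ(x) = Σ_ν refVal(x_k)_ν · (x_ν mod L^k)` — the linear potential of the
constant field `A₀ = refVal(x_k)` inside the block `B^k(x_k)`, normalised to vanish at the block corner («we "gauge away" the constant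
field», p. 593). [cite: Balaban1983RegularityDecay, §5 p.593] -/
def gaugeFn (A : HiggsLattice.VecField P 0) (k : ℕ) (x : HiggsLattice.Site P 0) : ℝ :=
  ∑ ν : Fin P.d, refVal A k (blockIter k x) ν * (((x ν).val % P.L ^ k : ℕ) : ℝ)

/-- **`A₀(Γ^{(k)}_{y,x}) = λ(x)`**: the contour sum (2.2) of the blockwise-constant field `A₀ ⟨z, ν⟩ = refVal(z_k)_ν` from the block
corner to `x` is the gauge function at `x` (every bond of `Γ^{(k)}_{y,x}` starts in `B^k(y)`, and direction `ν` is used `x_ν mod L^k`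
times; `k ≤ K`). [cite: Balaban1982Higgs1, (2.2) p.608] [cite: Balaban1983RegularityDecay, §5 p.593] -/
theorem multiContourSum_blockConst (hk : k ≤ P.K) (A : HiggsLattice.VecField P 0) (x : HiggsLattice.Site P 0) :
    multiContourSum (fun b : HiggsLattice.PBond P 0 => refVal A k (blockIter k b.src) b.dir) k x = gaugeFn A k x := by
  unfold multiContourSum gaugeFn
  -- each level-`i` staircase contributes `Σ_ν m_{i,ν} · refVal(x_k)_ν`
  have hlevel : ∀ i ∈ Finset.range k,
      contourSum (fun b : HiggsLattice.PBond P 0 => refVal A k (blockIter k b.src) b.dir)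
          (toFinest (blockIter (i + 1) x)) (toFinest (blockIter i x))
        = ∑ ν : Fin P.d, refVal A k (blockIter k x) ν *
            (((toFinest (blockIter i x)) ν - (toFinest (blockIter (i + 1) x)) ν).val : ℝ) := by
    intro i hi
    have hik : i < k := Finset.mem_range.1 hi
    unfold contourSum
    refine Finset.sum_congr rfl fun ν _ => ?_
    unfold segSum
    rw [corner_eq_cornerN]
    have hterm : ∀ s ∈ Finset.range ((toFinest (blockIter i x)) ν - (toFinest (blockIter (i + 1) x)) ν).val,
        refVal A k (blockIter k
          (shiftN (cornerN (toFinest (blockIter (i + 1) x)) (toFinest (blockIter i x)) (ν + 1)) ν s)) ν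
          = refVal A k (blockIter k x) ν := by
      intro s hs
      rw [blockIter_stair_src hik hk x ν (Finset.mem_range.1 hs)]
    rw [Finset.sum_congr rfl hterm, Finset.sum_const, Finset.card_range, nsmul_eq_mul, mul_comm]
  rw [Finset.sum_congr rfl hlevel, Finset.sum_comm]
  refine Finset.sum_congr rfl fun ν _ => ?_
  rw [← Finset.mul_sum, sum_steps_eq hk x ν]

/-- The sites per direction of every torus `T^{(k)}` number at least two ((1.2): `2L^{K−k}ML′_μ`). [cite: Balaban1982Higgs1, (1.2) p.604] -/
theorem two_le_sitesPerDir (k : ℕ) (μ : Fin P.d) : 2 ≤ P.sitesPerDir k μ := by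
  unfold HiggsLattice.Params.sitesPerDir
  have : 0 < P.L ^ (P.K - k) * P.M * P.Lp μ := Nat.mul_pos (Nat.mul_pos (pow_pos P.hL _) P.hM) (P.hLp μ)
  omega

/-- **On an intra-block bond the position advances by one**: if `z` and `z + εe_μ` lie in the same `k`-fold block (`k ≤ K`) then
`(z + εe_μ)_μ mod L^k = (z_μ mod L^k) + 1`. [cite: Balaban1982Higgs1, (1.20) p.607] -/
theorem pos_shift_self (hk : k ≤ P.K) {z : HiggsLattice.Site P 0} {μ : Fin P.d}
    (h : blockIter k (z.shift μ) = blockIter k z) :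
    ((z.shift μ) μ).val % P.L ^ k = (z μ).val % P.L ^ k + 1 := by
  have hS := two_le_sitesPerDir (P := P) k μ
  have hn0 : P.sitesPerDir 0 μ = P.L ^ k * P.sitesPerDir k μ := sitesPerDir_zero_eq hk μ
  have hLk : 0 < P.L ^ k := pow_pos P.hL k
  have hq : (((z.shift μ) μ).val) / P.L ^ k = (z μ).val / P.L ^ k := by
    have := congrArg (fun w : HiggsLattice.Site P k => (w μ).val) h
    simpa only [val_blockIter hk] using this
  have hval : ((z.shift μ) μ).val = ((z μ).val + 1) % P.sitesPerDir 0 μ := by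
    unfold HiggsLattice.Site.shift
    rw [Function.update_self, ZMod.val_add, ZMod.val_one_eq_one_mod, Nat.add_mod_mod]
  have hvlt : (z μ).val < P.sitesPerDir 0 μ := ZMod.val_lt _
  set v := (z μ).val with hv
  rw [hval] at hq ⊢
  by_cases hwrap : v + 1 < P.sitesPerDir 0 μ
  · rw [Nat.mod_eq_of_lt hwrap] at hq ⊢
    -- same quotient by `L^k` ⇒ the remainder advances by one
    have h1 := Nat.div_add_mod v (P.L ^ k)
    have h2 := Nat.div_add_mod (v + 1) (P.L ^ k)
    have h3 : (v + 1) % P.L ^ k < P.L ^ k := Nat.mod_lt _ hLk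
    have h4 : v % P.L ^ k < P.L ^ k := Nat.mod_lt _ hLk
    rw [hq] at h2
    omega
  · -- the wrap-around would force `sitesPerDir k μ ≤ 1`
    exfalso
    have heq : v + 1 = P.sitesPerDir 0 μ := by omega
    rw [heq, Nat.mod_self, Nat.zero_div] at hq
    have hvL : v < P.L ^ k := by
      by_contra hcon
      have : 1 ≤ v / P.L ^ k := (Nat.one_le_div_iff hLk).mpr (not_lt.mp hcon)
      omega
    have : P.L ^ k * 2 ≤ P.L ^ k * P.sitesPerDir k μ := Nat.mul_le_mul_left _ hS
    omega

/-- **The gauge function on an intra-block bond**: `λ(z + εe_μ) − λ(z) = refVal(z_k)_μ` whenever `z` and `z + εe_μ` lie in the same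
`k`-fold block (`k ≤ K`) — the blockwise-constant field IS the gradient of `λ` inside each block («we "gauge away" the constant
field»). [cite: Balaban1983RegularityDecay, §5 p.593] -/
theorem gaugeFn_shift (hk : k ≤ P.K) (A : HiggsLattice.VecField P 0) {z : HiggsLattice.Site P 0} {μ : Fin P.d}
    (h : blockIter k (z.shift μ) = blockIter k z) :
    gaugeFn A k (z.shift μ) = gaugeFn A k z + refVal A k (blockIter k z) μ := by
  unfold gaugeFn
  rw [h, ← Finset.sum_erase_add _ _ (Finset.mem_univ μ), ← Finset.sum_erase_add (Finset.univ) _ (Finset.mem_univ μ),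
    add_assoc]
  congr 1
  · refine Finset.sum_congr rfl fun ν hν => ?_
    have hνμ : ν ≠ μ := Finset.ne_of_mem_erase hν
    have : (z.shift μ) ν = z ν := by
      unfold HiggsLattice.Site.shift
      rw [Function.update_of_ne hνμ]
    rw [this]
  · rw [pos_shift_self hk h, Nat.cast_add, Nat.cast_one, mul_add, mul_one]

end Gauge

/-! ## §3 Regularity on `Ω` ⇒ the two smallness quantities -/

section Regularity

variable (Ω : Finset (HiggsLattice.Site P 0))

/-- **«A′ is small»**: for `A` with one-step differences `≤ δ` at the sites of a union of `k`-fold blocks `Ω` (`k ≤ K`) and `z ∈ Ω`,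
`|A ⟨z, ν⟩ − refVal(z_k)_ν| ≤ d(L^k − 1)·δ` — telescoping along the composite contour from the block corner to `z` (p23's
`abs_sub_le_of_multiStair`; every bond of it starts in `B^k(z_k) ⊂ Ω`). [cite: Balaban1983RegularityDecay, (2.23) p.579] -/
theorem abs_sub_refVal_le (hk : k ≤ P.K)
    (hΩ : ∀ x x' : HiggsLattice.Site P 0, blockIter k x = blockIter k x' → (x ∈ Ω ↔ x' ∈ Ω))
    (A : HiggsLattice.VecField P 0) {δ : ℝ}
    (hreg : ∀ z ∈ Ω, ∀ μ ν : Fin P.d, |A ⟨z.shift ν, μ⟩ - A ⟨z, μ⟩| ≤ δ)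
    {z : HiggsLattice.Site P 0} (hz : z ∈ Ω) (ν : Fin P.d) :
    |A ⟨z, ν⟩ - refVal A k (blockIter k z) ν| ≤ P.d * ((P.L : ℝ) ^ k - 1) * δ := by
  have hδ : 0 ≤ δ := by
    have h := hreg z hz ν ν
    exact (abs_nonneg _).trans h
  unfold refVal
  have h := abs_sub_le_of_multiStair (fun w : HiggsLattice.Site P 0 => A ⟨w, ν⟩) k z (δ := δ) ?_
  · refine h.trans (mul_le_mul_of_nonneg_right (sum_steps_le hk z) hδ)
  · intro i hi ν' s hs
    have hsrc := blockIter_stair_src hi hk z ν' hs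
    have hmem : shiftN (cornerN (toFinest (blockIter (i + 1) z)) (toFinest (blockIter i z)) (ν' + 1)) ν' s ∈ Ω :=
      (hΩ _ z hsrc).mpr hz
    exact hreg _ hmem ν ν'

/-- **«A′(Γ^{(k)}) is small»**: under the same regularity, for `x ∈ Ω`,
`|A(Γ^{(k)}_{y,x}) − λ(x)| ≤ (d(L^k − 1))²·δ` — `A − A₀` summed along the contour (p23's `abs_multiContourSum_le`), `A₀(Γ^{(k)}) = λ`.
[cite: Balaban1982Higgs1, (2.2) p.608] [cite: Balaban1983RegularityDecay, (2.23) p.579] -/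
theorem abs_multiContourSum_sub_gaugeFn_le (hk : k ≤ P.K)
    (hΩ : ∀ x x' : HiggsLattice.Site P 0, blockIter k x = blockIter k x' → (x ∈ Ω ↔ x' ∈ Ω))
    (A : HiggsLattice.VecField P 0) {δ : ℝ}
    (hreg : ∀ z ∈ Ω, ∀ μ ν : Fin P.d, |A ⟨z.shift ν, μ⟩ - A ⟨z, μ⟩| ≤ δ)
    {x : HiggsLattice.Site P 0} (hx : x ∈ Ω) :
    |multiContourSum A k x - gaugeFn A k x| ≤ (P.d * ((P.L : ℝ) ^ k - 1)) * (P.d * ((P.L : ℝ) ^ k - 1) * δ) := by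
  have hδ : 0 ≤ δ := by
    have h := hreg x hx ⟨0, P.hd⟩ ⟨0, P.hd⟩
    exact (abs_nonneg _).trans h
  have hα : 0 ≤ P.d * ((P.L : ℝ) ^ k - 1) * δ := by
    have hL : (1 : ℝ) ≤ (P.L : ℝ) ^ k := by exact_mod_cast Nat.one_le_pow _ _ P.hL
    have : (0 : ℝ) ≤ (P.L : ℝ) ^ k - 1 := by linarith
    positivity
  rw [← multiContourSum_blockConst hk A x, ← multiContourSum_sub]
  have h := abs_multiContourSum_le (A - fun b : HiggsLattice.PBond P 0 => refVal A k (blockIter k b.src) b.dir) k x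
    (β := P.d * ((P.L : ℝ) ^ k - 1) * δ) ?_
  · exact h.trans (mul_le_mul_of_nonneg_right (sum_steps_le hk x) hα)
  · intro i hi ν s hs
    have hsrc := blockIter_stair_src hi hk x ν hs
    have hmem : shiftN (cornerN (toFinest (blockIter (i + 1) x)) (toFinest (blockIter i x)) (ν + 1)) ν s ∈ Ω :=
      (hΩ _ x hsrc).mpr hx
    have h1 := abs_sub_refVal_le Ω hk hΩ A hreg hmem ν
    simp only [Pi.sub_apply]
    rw [hsrc] at h1
    rwa [hsrc]

end Regularity

/-! ## §4 The gauged field `φ = U(λ)ψ`: block sums and intra-block bond differences -/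

section Gauged

variable (C : ChargeData N)

/-- **The gauged field** `φ(x) = U(ελ(x)·… ) ψ(x) = exp(qεe·λ(x))ψ(x)` — `ψ` in the gauge in which the blockwise-constant part of `A`
has been removed («we "gauge away" the constant field»). [cite: Balaban1983RegularityDecay, §5 p.593] -/
def gauged (A : HiggsLattice.VecField P 0) (k : ℕ) (ψ : ScalarField P 0 N) : ScalarField P 0 N :=
  fun x => C.U (P.mesh 0) (gaugeFn A k x) (ψ x)

/-- The gauge transformation is sitewise unitary: `‖φ(x)‖ = ‖ψ(x)‖`. [cite: Balaban1982Higgs1, (1.7) p.605] -/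
theorem norm_gauged (A : HiggsLattice.VecField P 0) (k : ℕ) (ψ : ScalarField P 0 N) (x : HiggsLattice.Site P 0) :
    ‖gauged C A k ψ x‖ = ‖ψ x‖ :=
  norm_U_apply C _ _ _

/-- **`Q_k(A)ψ = Q_k(A′)φ` up to the small transports of `A′`**: on one `k`-fold block,
`‖Σ_{x∈B^k(y)} φ(x)‖ ≤ ‖Σ_{x∈B^k(y)} U(A(Γ^{(k)}_{y,x}))ψ(x)‖ + θ′·Σ_{x∈B^k(y)}‖ψ(x)‖` whenever `ε|e|·|A(Γ^{(k)}_{y,x}) − λ(x)| ≤ θ′` on the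
block (`U(A(Γ)) = U(A(Γ) − λ)U(λ)` exactly, `‖U(a)w − w‖ ≤ |εea|‖w‖`). [cite: Balaban1983RegularityDecay, (2.24) p.579] -/
theorem norm_sum_gauged_le (A : HiggsLattice.VecField P 0) (y : HiggsLattice.Site P k) {θ' : ℝ}
    (hθ : ∀ x ∈ blockK k y, |P.mesh 0 * C.e * (multiContourSum A k x - gaugeFn A k x)| ≤ θ') (ψ : ScalarField P 0 N) :
    ‖∑ x ∈ blockK k y, gauged C A k ψ x‖
      ≤ ‖∑ x ∈ blockK k y, C.U (P.mesh 0) (multiContourSum A k x) (ψ x)‖ + θ' * ∑ x ∈ blockK k y, ‖ψ x‖ := by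
  have hx : ∀ x, C.U (P.mesh 0) (multiContourSum A k x) (ψ x)
      = C.U (P.mesh 0) (multiContourSum A k x - gaugeFn A k x) (gauged C A k ψ x) := by
    intro x
    unfold gauged
    rw [U_apply_U, sub_add_cancel]
  have hsplit : ∑ x ∈ blockK k y, gauged C A k ψ x
      = ∑ x ∈ blockK k y, C.U (P.mesh 0) (multiContourSum A k x) (ψ x)
        - ∑ x ∈ blockK k y, (C.U (P.mesh 0) (multiContourSum A k x - gaugeFn A k x) (gauged C A k ψ x) - gauged C A k ψ x) := by
    rw [← Finset.sum_sub_distrib]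
    refine Finset.sum_congr rfl fun x _ => ?_
    rw [hx]; abel
  rw [hsplit]
  refine (norm_sub_le _ _).trans (add_le_add le_rfl ?_)
  refine (norm_sum_le _ _).trans ?_
  rw [Finset.mul_sum]
  refine Finset.sum_le_sum fun x hxB => ?_
  calc ‖C.U (P.mesh 0) (multiContourSum A k x - gaugeFn A k x) (gauged C A k ψ x) - gauged C A k ψ x‖
      ≤ |P.mesh 0 * C.e * (multiContourSum A k x - gaugeFn A k x)| * ‖gauged C A k ψ x‖ := norm_U_apply_sub_le C _ _ _
    _ ≤ θ' * ‖ψ x‖ := by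
        rw [norm_gauged]
        exact mul_le_mul_of_nonneg_right (hθ x hxB) (norm_nonneg _)

/-- **The gauged bond difference**: for a bond `b` inside one `k`-fold block (`k ≤ K`) with `ε|e|·|refVal(b₋,k)_μ − A_b| ≤ θ″`,
`‖φ(b₊) − φ(b₋)‖ ≤ ε‖(D^ε_Aψ)(b)‖ + θ″‖ψ(b₊)‖` — since `λ(b₊) − λ(b₋) = refVal_μ` the gauged difference is `U(refVal_μ)ψ(b₊) − ψ(b₋)`,
i.e. the covariant difference of `A′ = A − A₀` up to `U(A′_b) − 1`. [cite: Balaban1983RegularityDecay, (2.23)–(2.24) p.579] -/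
theorem norm_gauged_bond_le (hk : k ≤ P.K) (A : HiggsLattice.VecField P 0) (b : HiggsLattice.PBond P 0)
    (hb : blockIter k b.tgt = blockIter k b.src) {θ'' : ℝ}
    (hθ : |P.mesh 0 * C.e * (refVal A k (blockIter k b.src) b.dir - A b)| ≤ θ'') (ψ : ScalarField P 0 N) :
    ‖gauged C A k ψ b.tgt - gauged C A k ψ b.src‖ ≤ P.mesh 0 * ‖covDeriv C A ψ b‖ + θ'' * ‖ψ b.tgt‖ := by
  have hm : 0 < P.mesh 0 := P.mesh_pos 0
  set a : ℝ := refVal A k (blockIter k b.src) b.dir with ha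
  have hshift : gaugeFn A k b.tgt = gaugeFn A k b.src + a := by
    have h := gaugeFn_shift hk A (z := b.src) (μ := b.dir) hb
    exact h
  have hdiff : gauged C A k ψ b.tgt - gauged C A k ψ b.src
      = C.U (P.mesh 0) (gaugeFn A k b.src) (C.U (P.mesh 0) a (ψ b.tgt) - ψ b.src) := by
    unfold gauged
    rw [map_sub, U_apply_U, hshift]
  have hcov : C.U (P.mesh 0) (A b) (ψ b.tgt) - ψ b.src = (P.mesh 0) • covDeriv C A ψ b := by
    unfold HiggsLattice.covDeriv
    rw [smul_smul, mul_inv_cancel₀ hm.ne', one_smul]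
  have hpert : C.U (P.mesh 0) a (ψ b.tgt) - C.U (P.mesh 0) (A b) (ψ b.tgt)
      = C.U (P.mesh 0) (A b) (C.U (P.mesh 0) (a - A b) (ψ b.tgt) - ψ b.tgt) := by
    rw [map_sub, U_apply_U, add_sub_cancel]
  rw [hdiff, norm_U_apply]
  calc ‖C.U (P.mesh 0) a (ψ b.tgt) - ψ b.src‖
      = ‖(C.U (P.mesh 0) (A b) (ψ b.tgt) - ψ b.src) + (C.U (P.mesh 0) a (ψ b.tgt) - C.U (P.mesh 0) (A b) (ψ b.tgt))‖ := by
        congr 1; abel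
    _ ≤ ‖C.U (P.mesh 0) (A b) (ψ b.tgt) - ψ b.src‖ + ‖C.U (P.mesh 0) a (ψ b.tgt) - C.U (P.mesh 0) (A b) (ψ b.tgt)‖ :=
        norm_add_le _ _
    _ ≤ P.mesh 0 * ‖covDeriv C A ψ b‖ + θ'' * ‖ψ b.tgt‖ := by
        refine add_le_add ?_ ?_
        · rw [hcov, norm_smul, Real.norm_eq_abs, abs_of_pos hm]
        · rw [hpert, norm_U_apply]
          exact (norm_U_apply_sub_le C _ _ _).trans (mul_le_mul_of_nonneg_right hθ (norm_nonneg _))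

end Gauged

/-! ## §5 The block estimate and (1.8) at a regular `A` for regions -/

section Coercive

variable (C : ChargeData N) {a msq : ℝ}

/-- **One `k`-fold block** (`k ≤ K`): if `ε|e|·|A(Γ^{(k)}_{y,x}) − λ(x)| ≤ θ′` on `B^k(y)` and `ε|e|·|refVal_μ − A_b| ≤ θ″` on its inside
bonds, then with `S = Σ_{B^k(y)}‖ψ‖²`, `V = ‖Σ_{B^k(y)}U(A(Γ^{(k)}))ψ‖`, `D = Σ_{b⊂B^k(y)}‖D^ε_Aψ(b)‖²`, `T = Σ_{b⊂B^k(y)}‖ψ(b₊)‖²`: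
`S ≤ 2L^{−kd}V² + 2θ′²S + (L^{2k}ε²/4)D + (L^{2k}θ″²/4)T` — the zero-field Poincaré inequality for the gauged field plus the two
perturbation budgets («quadratic form considerations», p. 579). [cite: Balaban1983RegularityDecay, (1.8) p.573; (2.24)–(2.27) pp.579–580] -/
theorem block_estimate (hk : k ≤ P.K) (A : HiggsLattice.VecField P 0) (y : HiggsLattice.Site P k) {θ' θ'' : ℝ}
    (hθ' : ∀ x ∈ blockK k y, |P.mesh 0 * C.e * (multiContourSum A k x - gaugeFn A k x)| ≤ θ')
    (hθ'' : ∀ b : HiggsLattice.PBond P 0, Inside (blockK k y) b →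
      |P.mesh 0 * C.e * (refVal A k (blockIter k b.src) b.dir - A b)| ≤ θ'') (ψ : ScalarField P 0 N) :
    ∑ x ∈ blockK k y, ‖ψ x‖ ^ 2
      ≤ 2 * ((P.L : ℝ) ^ (k * P.d))⁻¹ * ‖∑ x ∈ blockK k y, C.U (P.mesh 0) (multiContourSum A k x) (ψ x)‖ ^ 2
        + 2 * θ' ^ 2 * ∑ x ∈ blockK k y, ‖ψ x‖ ^ 2
        + ((P.L : ℝ) ^ k) ^ 2 * P.mesh 0 ^ 2 / 4 *
            ∑ b : HiggsLattice.PBond P 0, (if Inside (blockK k y) b then ‖covDeriv C A ψ b‖ ^ 2 else 0)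
        + ((P.L : ℝ) ^ k) ^ 2 * θ'' ^ 2 / 4 *
            ∑ b : HiggsLattice.PBond P 0, (if Inside (blockK k y) b then ‖ψ b.tgt‖ ^ 2 else 0) := by
  classical
  set φ := gauged C A k ψ with hφ
  set S := ∑ x ∈ blockK k y, ‖ψ x‖ ^ 2 with hS
  set V := ‖∑ x ∈ blockK k y, C.U (P.mesh 0) (multiContourSum A k x) (ψ x)‖ with hV
  set D := ∑ b : HiggsLattice.PBond P 0, (if Inside (blockK k y) b then ‖covDeriv C A ψ b‖ ^ 2 else 0) with hD
  set T := ∑ b : HiggsLattice.PBond P 0, (if Inside (blockK k y) b then ‖ψ b.tgt‖ ^ 2 else 0) with hT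
  have hLkd : (0 : ℝ) < (P.L : ℝ) ^ (k * P.d) := pow_pos (by exact_mod_cast P.hL) _
  have hm : 0 < P.mesh 0 := P.mesh_pos 0
  -- Poincaré for the gauged field
  have hP := blockK_poincare_vec hk y φ
  have hSφ : ∑ x ∈ blockK k y, ‖φ x‖ ^ 2 = S := by
    rw [hS]; exact Finset.sum_congr rfl fun x _ => by rw [hφ, norm_gauged]
  rw [hSφ] at hP
  -- the block sum of the gauged field
  have hW := norm_sum_gauged_le C A y hθ' ψ
  have hCS : (∑ x ∈ blockK k y, ‖ψ x‖) ^ 2 ≤ (P.L : ℝ) ^ (k * P.d) * S := by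
    have h := sq_sum_le_card_mul_sum_sq (s := blockK k y) (f := fun x => ‖ψ x‖)
    rw [card_blockK hk] at h
    push_cast at h
    exact h
  have hW2 : ‖∑ x ∈ blockK k y, φ x‖ ^ 2 ≤ 2 * V ^ 2 + 2 * θ' ^ 2 * ((P.L : ℝ) ^ (k * P.d) * S) := by
    have h0 : 0 ≤ ‖∑ x ∈ blockK k y, φ x‖ := norm_nonneg _
    have h1 : ‖∑ x ∈ blockK k y, φ x‖ ^ 2 ≤ (V + θ' * ∑ x ∈ blockK k y, ‖ψ x‖) ^ 2 :=
      pow_le_pow_left₀ h0 hW 2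
    have h2 : (V + θ' * ∑ x ∈ blockK k y, ‖ψ x‖) ^ 2 ≤ 2 * V ^ 2 + 2 * (θ' * ∑ x ∈ blockK k y, ‖ψ x‖) ^ 2 := by
      nlinarith [sq_nonneg (V - θ' * ∑ x ∈ blockK k y, ‖ψ x‖)]
    have h3 : (θ' * ∑ x ∈ blockK k y, ‖ψ x‖) ^ 2 ≤ θ' ^ 2 * ((P.L : ℝ) ^ (k * P.d) * S) := by
      rw [mul_pow]; exact mul_le_mul_of_nonneg_left hCS (sq_nonneg _)
    linarith
  -- the inside bonds
  have hB : ∑ b : HiggsLattice.PBond P 0, (if Inside (blockK k y) b then ‖φ b.tgt - φ b.src‖ ^ 2 else 0)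
      ≤ 2 * P.mesh 0 ^ 2 * D + 2 * θ'' ^ 2 * T := by
    rw [hD, hT, Finset.mul_sum, Finset.mul_sum, ← Finset.sum_add_distrib]
    refine Finset.sum_le_sum fun b _ => ?_
    split_ifs with hb
    · have hbb : blockIter k b.tgt = blockIter k b.src := by
        rw [(mem_blockK k y _).mp hb.2, (mem_blockK k y _).mp hb.1]
      have h1 := norm_gauged_bond_le C hk A b hbb (hθ'' b hb) ψ
      have h0 : 0 ≤ ‖φ b.tgt - φ b.src‖ := norm_nonneg _
      have h2 := pow_le_pow_left₀ h0 h1 2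
      nlinarith [sq_nonneg (P.mesh 0 * ‖covDeriv C A ψ b‖ - θ'' * ‖ψ b.tgt‖)]
    · simp
  -- assemble
  have hL8 : 0 ≤ ((P.L : ℝ) ^ k) ^ 2 / 8 := by positivity
  have h1 : S - ((P.L : ℝ) ^ (k * P.d))⁻¹ * ‖∑ x ∈ blockK k y, φ x‖ ^ 2
      ≤ ((P.L : ℝ) ^ k) ^ 2 / 8 * (2 * P.mesh 0 ^ 2 * D + 2 * θ'' ^ 2 * T) := hP.trans (mul_le_mul_of_nonneg_left hB hL8)
  have h2 : ((P.L : ℝ) ^ (k * P.d))⁻¹ * ‖∑ x ∈ blockK k y, φ x‖ ^ 2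
      ≤ 2 * ((P.L : ℝ) ^ (k * P.d))⁻¹ * V ^ 2 + 2 * θ' ^ 2 * S := by
    have h := mul_le_mul_of_nonneg_left hW2 (inv_pos.mpr hLkd).le
    have e : ((P.L : ℝ) ^ (k * P.d))⁻¹ * (2 * V ^ 2 + 2 * θ' ^ 2 * ((P.L : ℝ) ^ (k * P.d) * S))
        = 2 * ((P.L : ℝ) ^ (k * P.d))⁻¹ * V ^ 2 + 2 * θ' ^ 2 * S := by
      field_simp
    linarith
  have e3 : ((P.L : ℝ) ^ k) ^ 2 / 8 * (2 * P.mesh 0 ^ 2 * D + 2 * θ'' ^ 2 * T)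
      = ((P.L : ℝ) ^ k) ^ 2 * P.mesh 0 ^ 2 / 4 * D + ((P.L : ℝ) ^ k) ^ 2 * θ'' ^ 2 / 4 * T := by ring
  linarith

/-- The `k`-fold block sums of `‖(D^ε_Aψ)(b)‖²` over the blocks are bounded by the Neumann sum over the bonds INSIDE `Ω`, for `Ω` a union
of `k`-fold blocks and `ψ` supported in `Ω` (a bond inside a block off `Ω` carries `D^ε_Aψ = 0`). [cite: Balaban1982Higgs1, (2.17) p.610] -/
theorem sum_blocksK_cov_le_inside (Ω : Finset (HiggsLattice.Site P 0))
    (hΩ : ∀ x x' : HiggsLattice.Site P 0, blockIter k x = blockIter k x' → (x ∈ Ω ↔ x' ∈ Ω))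
    (A : HiggsLattice.VecField P 0) (ψ : ScalarField P 0 N) (hψ : ∀ x, x ∉ Ω → ψ x = 0) :
    ∑ y : HiggsLattice.Site P k, ∑ b : HiggsLattice.PBond P 0,
        (if Inside (blockK k y) b then ‖covDeriv C A ψ b‖ ^ 2 else 0)
      ≤ ∑ b : HiggsLattice.PBond P 0, (if Inside Ω b then ‖covDeriv C A ψ b‖ ^ 2 else 0) := by
  classical
  rw [Finset.sum_comm]
  refine Finset.sum_le_sum fun b _ => ?_
  by_cases hb : Inside Ω b
  · rw [if_pos hb]
    exact sum_ite_inside_blockK_le b (sq_nonneg _)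
  · rw [if_neg hb]
    refine Finset.sum_nonpos fun y _ => ?_
    by_cases hy : Inside (blockK k y) b
    · rw [if_pos hy]
      have hsrc : blockIter k b.src = y := (mem_blockK k y _).mp hy.1
      have htgt : blockIter k b.tgt = y := (mem_blockK k y _).mp hy.2
      have hiff : b.src ∈ Ω ↔ b.tgt ∈ Ω := hΩ b.src b.tgt (by rw [hsrc, htgt])
      have hs : b.src ∉ Ω := fun h => hb ⟨h, hiff.mp h⟩
      have ht : b.tgt ∉ Ω := fun h => hs (hiff.mpr h)
      have : covDeriv C A ψ b = 0 := by
        unfold HiggsLattice.covDeriv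
        rw [hψ _ hs, hψ _ ht, map_zero, sub_zero, smul_zero]
      rw [this, norm_zero]
      norm_num
    · rw [if_neg hy]

/-- **The summed block estimates**: if on every `k`-fold block (`k ≤ K`) the inequality of `block_estimate` holds with the same `θ′, θ″`
(for a union of `k`-fold blocks `Ω` and `ψ` supported in `Ω`), then
`‖ψ‖² ≤ 2⟨ψ, P_k(A)ψ⟩ + 2θ′²‖ψ‖² + ((L^kε)²/4)⟨ψ, −Δ^{ε,N}_{A,Ω}ψ⟩ + (L^{2k}θ″²d/4)‖ψ‖²` — the blocks summed with the weight `ε^d`,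
`P_k(A) = Q_k^*(A)Q_k(A)` block-diagonal, the bond sums collected into the Neumann form. [cite: Balaban1983RegularityDecay, (1.8) p.573; §5 p.593] -/
theorem summed_estimate (Ω : Finset (HiggsLattice.Site P 0))
    (hΩ : ∀ x x' : HiggsLattice.Site P 0, blockIter k x = blockIter k x' → (x ∈ Ω ↔ x' ∈ Ω))
    (A : HiggsLattice.VecField P 0) {θ' θ'' : ℝ} (ψ : ScalarField P 0 N) (hψ : ∀ x, x ∉ Ω → ψ x = 0)
    (hblock : ∀ y : HiggsLattice.Site P k,
      ∑ x ∈ blockK k y, ‖ψ x‖ ^ 2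
        ≤ 2 * ((P.L : ℝ) ^ (k * P.d))⁻¹ * ‖∑ x ∈ blockK k y, C.U (P.mesh 0) (multiContourSum A k x) (ψ x)‖ ^ 2
          + 2 * θ' ^ 2 * ∑ x ∈ blockK k y, ‖ψ x‖ ^ 2
          + ((P.L : ℝ) ^ k) ^ 2 * P.mesh 0 ^ 2 / 4 *
              ∑ b : HiggsLattice.PBond P 0, (if Inside (blockK k y) b then ‖covDeriv C A ψ b‖ ^ 2 else 0)
          + ((P.L : ℝ) ^ k) ^ 2 * θ'' ^ 2 / 4 *
              ∑ b : HiggsLattice.PBond P 0, (if Inside (blockK k y) b then ‖ψ b.tgt‖ ^ 2 else 0)) :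
    siteInner ψ ψ ≤ 2 * siteInner ψ (projPk C A k ψ) + 2 * θ' ^ 2 * siteInner ψ ψ
      + P.mesh k ^ 2 / 4 * siteInner ψ (covLaplacianN C Ω A ψ)
      + ((P.L : ℝ) ^ k) ^ 2 * θ'' ^ 2 / 4 * P.d * siteInner ψ ψ := by
  classical
  have hm : 0 < P.mesh 0 := P.mesh_pos 0
  have hmd : 0 < P.mesh 0 ^ P.d := pow_pos hm _
  have hLkd : (0 : ℝ) < (P.L : ℝ) ^ (k * P.d) := pow_pos (by exact_mod_cast P.hL) _
  -- names for the four block sums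
  obtain ⟨Ss, hSs⟩ : ∃ Ss : ℝ, Ss = ∑ y : HiggsLattice.Site P k, ∑ x ∈ blockK k y, ‖ψ x‖ ^ 2 := ⟨_, rfl⟩
  obtain ⟨Vs, hVs⟩ : ∃ Vs : ℝ, Vs = ∑ y : HiggsLattice.Site P k,
    ‖∑ x ∈ blockK k y, C.U (P.mesh 0) (multiContourSum A k x) (ψ x)‖ ^ 2 := ⟨_, rfl⟩
  obtain ⟨Ds, hDs⟩ : ∃ Ds : ℝ, Ds = ∑ y : HiggsLattice.Site P k, ∑ b : HiggsLattice.PBond P 0,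
    (if Inside (blockK k y) b then ‖covDeriv C A ψ b‖ ^ 2 else 0) := ⟨_, rfl⟩
  obtain ⟨Ts, hTs⟩ : ∃ Ts : ℝ, Ts = ∑ y : HiggsLattice.Site P k, ∑ b : HiggsLattice.PBond P 0,
    (if Inside (blockK k y) b then ‖ψ b.tgt‖ ^ 2 else 0) := ⟨_, rfl⟩
  -- the summed block estimate
  have hsum : Ss ≤ 2 * ((P.L : ℝ) ^ (k * P.d))⁻¹ * Vs + 2 * θ' ^ 2 * Ss
      + ((P.L : ℝ) ^ k) ^ 2 * P.mesh 0 ^ 2 / 4 * Ds + ((P.L : ℝ) ^ k) ^ 2 * θ'' ^ 2 / 4 * Ts := by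
    have h := Finset.sum_le_sum fun y (_ : y ∈ (Finset.univ : Finset (HiggsLattice.Site P k))) => hblock y
    rw [Finset.sum_add_distrib, Finset.sum_add_distrib, Finset.sum_add_distrib, ← Finset.mul_sum, ← Finset.mul_sum,
      ← Finset.mul_sum, ← Finset.mul_sum] at h
    rw [hSs, hVs, hDs, hTs]
    exact h
  -- identify the terms
  have h1 : siteInner ψ ψ = P.mesh 0 ^ P.d * Ss := by
    rw [hSs, siteInner, ← Finset.mul_sum]
    congr 1
    simp_rw [real_inner_self_eq_norm_sq]
    exact (Finset.sum_fiberwise_of_maps_to (s := Finset.univ) (t := Finset.univ)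
      (g := fun x : HiggsLattice.Site P 0 => blockIter k x) (fun _ _ => Finset.mem_univ _) _).symm
  have h2 : siteInner ψ (projPk C A k ψ) = P.mesh 0 ^ P.d * (((P.L : ℝ) ^ (k * P.d))⁻¹ * Vs) := by
    rw [hVs, siteInner_projPk, siteInner_self_eq]
    have havg : ∀ y, avgQkLin C A k ψ y
        = (((P.L : ℝ) ^ (k * P.d))⁻¹) • ∑ x ∈ blockK k y, C.U (P.mesh 0) (multiContourSum A k x) (ψ x) := by
      intro y; rw [avgQkLin_apply, avgQk_apply]
    simp_rw [havg, norm_smul, mul_pow, Real.norm_eq_abs, abs_of_pos (inv_pos.mpr hLkd), mesh_pow_d k]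
    rw [Finset.mul_sum, Finset.mul_sum]
    refine Finset.sum_congr rfl fun y _ => ?_
    field_simp
  have h3 : P.mesh 0 ^ P.d * Ds ≤ siteInner ψ (covLaplacianN C Ω A ψ) := by
    have e : siteInner ψ (covLaplacianN C Ω A ψ)
        = P.mesh 0 ^ P.d * ∑ b : HiggsLattice.PBond P 0, (if Inside Ω b then ‖covDeriv C A ψ b‖ ^ 2 else 0) := by
      rw [siteInner_covLaplacianN, Finset.mul_sum]
      refine Finset.sum_congr rfl fun b _ => ?_
      split_ifs
      · rw [real_inner_self_eq_norm_sq]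
      · simp
    rw [e, hDs]
    exact mul_le_mul_of_nonneg_left (sum_blocksK_cov_le_inside C Ω hΩ A ψ hψ) hmd.le
  have h4 : P.mesh 0 ^ P.d * Ts ≤ P.d * siteInner ψ ψ := by
    rw [← sum_bond_tgt_sq, hTs]
    have e : ∑ y : HiggsLattice.Site P k, ∑ b : HiggsLattice.PBond P 0, (if Inside (blockK k y) b then ‖ψ b.tgt‖ ^ 2 else 0)
        = ∑ b : HiggsLattice.PBond P 0, ∑ y : HiggsLattice.Site P k, (if Inside (blockK k y) b then ‖ψ b.tgt‖ ^ 2 else 0) :=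
      Finset.sum_comm
    rw [e, Finset.mul_sum]
    refine Finset.sum_le_sum fun b _ => ?_
    exact mul_le_mul_of_nonneg_left (sum_ite_inside_blockK_le b (sq_nonneg _)) hmd.le
  -- multiply the summed estimate by ε^d and rewrite
  have hmain := mul_le_mul_of_nonneg_left hsum hmd.le
  have hmesh : P.mesh k ^ 2 = ((P.L : ℝ) ^ k) ^ 2 * P.mesh 0 ^ 2 := by rw [mesh_eq k]; ring
  have e : P.mesh 0 ^ P.d * (2 * ((P.L : ℝ) ^ (k * P.d))⁻¹ * Vs + 2 * θ' ^ 2 * Ss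
      + ((P.L : ℝ) ^ k) ^ 2 * P.mesh 0 ^ 2 / 4 * Ds + ((P.L : ℝ) ^ k) ^ 2 * θ'' ^ 2 / 4 * Ts)
      = 2 * (P.mesh 0 ^ P.d * (((P.L : ℝ) ^ (k * P.d))⁻¹ * Vs)) + 2 * θ' ^ 2 * (P.mesh 0 ^ P.d * Ss)
        + ((P.L : ℝ) ^ k) ^ 2 * P.mesh 0 ^ 2 / 4 * (P.mesh 0 ^ P.d * Ds)
        + ((P.L : ℝ) ^ k) ^ 2 * θ'' ^ 2 / 4 * (P.mesh 0 ^ P.d * Ts) := by ring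
  rw [e, ← h1, ← h2] at hmain
  have hc3 : 0 ≤ ((P.L : ℝ) ^ k) ^ 2 * P.mesh 0 ^ 2 / 4 := by positivity
  have hc4 : 0 ≤ ((P.L : ℝ) ^ k) ^ 2 * θ'' ^ 2 / 4 := by positivity
  have h3' : ((P.L : ℝ) ^ k) ^ 2 * P.mesh 0 ^ 2 / 4 * (P.mesh 0 ^ P.d * Ds)
      ≤ P.mesh k ^ 2 / 4 * siteInner ψ (covLaplacianN C Ω A ψ) := by
    rw [hmesh]
    have := mul_le_mul_of_nonneg_left h3 hc3
    linarith
  have h4' : ((P.L : ℝ) ^ k) ^ 2 * θ'' ^ 2 / 4 * (P.mesh 0 ^ P.d * Ts)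
      ≤ ((P.L : ℝ) ^ k) ^ 2 * θ'' ^ 2 / 4 * P.d * siteInner ψ ψ := by
    have := mul_le_mul_of_nonneg_left h4 hc4
    linarith
  linarith

/-- **The two perturbation budgets from one smallness condition**: with `ℓ = d(L^k − 1)`, `θ′ = ε|e|ℓ²δ`, `θ″ = ε|e|ℓδ` and
`τ = d²·ε|e|·L^{2k}·δ ≤ 1/3` (`δ ≥ 0`): `2θ′² ≤ 1/4` and `L^{2k}θ″²d/4 ≤ 1/4`. [cite: Balaban1983RegularityDecay, (1.8) p.573] -/
theorem budgets {δ : ℝ} (hδ : 0 ≤ δ)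
    (hsmall : (P.d : ℝ) ^ 2 * (P.mesh 0 * |C.e|) * ((P.L : ℝ) ^ k) ^ 2 * δ ≤ 1 / 3) :
    2 * (P.mesh 0 * |C.e| * ((P.d * ((P.L : ℝ) ^ k - 1)) * ((P.d * ((P.L : ℝ) ^ k - 1)) * δ))) ^ 2 ≤ 1 / 4 ∧
      ((P.L : ℝ) ^ k) ^ 2 * (P.mesh 0 * |C.e| * ((P.d * ((P.L : ℝ) ^ k - 1)) * δ)) ^ 2 / 4 * P.d ≤ 1 / 4 := by
  have hm : 0 < P.mesh 0 := P.mesh_pos 0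
  have hLk1 : (1 : ℝ) ≤ (P.L : ℝ) ^ k := by exact_mod_cast Nat.one_le_pow _ _ P.hL
  have hd1 : (1 : ℝ) ≤ P.d := by exact_mod_cast P.hd
  have hme : 0 ≤ P.mesh 0 * |C.e| := mul_nonneg hm.le (abs_nonneg _)
  set ℓ : ℝ := P.d * ((P.L : ℝ) ^ k - 1) with hℓ
  set τ : ℝ := (P.d : ℝ) ^ 2 * (P.mesh 0 * |C.e|) * ((P.L : ℝ) ^ k) ^ 2 * δ with hτ
  have hℓ0 : 0 ≤ ℓ := mul_nonneg (by linarith) (by linarith)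
  have hℓle : ℓ ≤ P.d * (P.L : ℝ) ^ k := by rw [hℓ]; nlinarith
  have hτ0 : 0 ≤ τ := by rw [hτ]; positivity
  -- θ′ ≤ τ
  have hθ'τ : P.mesh 0 * |C.e| * (ℓ * (ℓ * δ)) ≤ τ := by
    have h1 : ℓ * (ℓ * δ) ≤ (P.d * (P.L : ℝ) ^ k) * ((P.d * (P.L : ℝ) ^ k) * δ) :=
      mul_le_mul hℓle (mul_le_mul_of_nonneg_right hℓle hδ) (by positivity) (by positivity)
    have h2 := mul_le_mul_of_nonneg_left h1 hme
    have e : P.mesh 0 * |C.e| * ((P.d * (P.L : ℝ) ^ k) * ((P.d * (P.L : ℝ) ^ k) * δ)) = τ := by rw [hτ]; ring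
    linarith
  have hθ'0 : 0 ≤ P.mesh 0 * |C.e| * (ℓ * (ℓ * δ)) := by positivity
  -- θ″·(dL^k) ≤ τ
  have hθ''τ : P.mesh 0 * |C.e| * (ℓ * δ) * (P.d * (P.L : ℝ) ^ k) ≤ τ := by
    have h1 : ℓ * δ ≤ (P.d * (P.L : ℝ) ^ k) * δ := mul_le_mul_of_nonneg_right hℓle hδ
    have h2 : P.mesh 0 * |C.e| * (ℓ * δ) ≤ P.mesh 0 * |C.e| * ((P.d * (P.L : ℝ) ^ k) * δ) :=
      mul_le_mul_of_nonneg_left h1 hme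
    have h3 := mul_le_mul_of_nonneg_right h2 (show (0 : ℝ) ≤ P.d * (P.L : ℝ) ^ k by positivity)
    have e : P.mesh 0 * |C.e| * ((P.d * (P.L : ℝ) ^ k) * δ) * (P.d * (P.L : ℝ) ^ k) = τ := by rw [hτ]; ring
    linarith
  have hθ''0 : 0 ≤ P.mesh 0 * |C.e| * (ℓ * δ) := by positivity
  constructor
  · have hsq : (P.mesh 0 * |C.e| * (ℓ * (ℓ * δ))) ^ 2 ≤ τ ^ 2 := pow_le_pow_left₀ hθ'0 hθ'τ 2
    nlinarith
  · have hsq : (P.mesh 0 * |C.e| * (ℓ * δ) * (P.d * (P.L : ℝ) ^ k)) ^ 2 ≤ τ ^ 2 :=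
      pow_le_pow_left₀ (by positivity) hθ''τ 2
    -- L^{2k}θ″²d/4 ≤ d²L^{2k}θ″²/4 = (θ″dL^k)²/4 ≤ τ²/4 ≤ 1/36
    have hA : ((P.L : ℝ) ^ k) ^ 2 * (P.mesh 0 * |C.e| * (ℓ * δ)) ^ 2 / 4 * P.d
        ≤ (P.mesh 0 * |C.e| * (ℓ * δ) * (P.d * (P.L : ℝ) ^ k)) ^ 2 / 4 := by
      have hx : 0 ≤ ((P.L : ℝ) ^ k) ^ 2 * (P.mesh 0 * |C.e| * (ℓ * δ)) ^ 2 / 4 := by positivity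
      have e : (P.mesh 0 * |C.e| * (ℓ * δ) * (P.d * (P.L : ℝ) ^ k)) ^ 2 / 4
          = ((P.L : ℝ) ^ k) ^ 2 * (P.mesh 0 * |C.e| * (ℓ * δ)) ^ 2 / 4 * (P.d * P.d) := by ring
      rw [e]
      have hdd : (P.d : ℝ) ≤ P.d * P.d := by nlinarith
      exact mul_le_mul_of_nonneg_left hdd hx
    nlinarith

/-- **`‖ψ‖² ≤ 4⟨ψ, P_k(A)ψ⟩ + ((L^kε)²/2)⟨ψ, −Δ^{ε,N}_{A,Ω}ψ⟩`** for `Ω ⊂ T_ε` a union of `k`-fold blocks (`k ≤ K`), `A` with one-step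
differences `≤ δ` on `Ω` and the smallness `d²·ε|e|·L^{2k}·δ ≤ 1/3`, and every field `ψ` supported in `Ω` — the block estimates summed
over the blocks, the two perturbation budgets absorbed («quadratic form considerations»). [cite: Balaban1983RegularityDecay, (1.8) p.573; p.579; p.593] -/
theorem siteInner_self_le_projPk_add_cov (hk : k ≤ P.K) (Ω : Finset (HiggsLattice.Site P 0))
    (hΩ : ∀ x x' : HiggsLattice.Site P 0, blockIter k x = blockIter k x' → (x ∈ Ω ↔ x' ∈ Ω))
    (A : HiggsLattice.VecField P 0) {δ : ℝ}
    (hreg : ∀ z ∈ Ω, ∀ μ ν : Fin P.d, |A ⟨z.shift ν, μ⟩ - A ⟨z, μ⟩| ≤ δ)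
    (hsmall : (P.d : ℝ) ^ 2 * (P.mesh 0 * |C.e|) * ((P.L : ℝ) ^ k) ^ 2 * δ ≤ 1 / 3)
    (ψ : ScalarField P 0 N) (hψ : ∀ x, x ∉ Ω → ψ x = 0) :
    siteInner ψ ψ ≤ 4 * siteInner ψ (projPk C A k ψ) + P.mesh k ^ 2 / 2 * siteInner ψ (covLaplacianN C Ω A ψ) := by
  classical
  have hm : 0 < P.mesh 0 := P.mesh_pos 0
  have hme : 0 ≤ P.mesh 0 * |C.e| := mul_nonneg hm.le (abs_nonneg _)
  -- the empty region: ψ = 0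
  by_cases hΩe : Ω = ∅
  · have hψ0 : ψ = 0 := funext fun x => hψ x (by rw [hΩe]; exact Finset.notMem_empty x)
    rw [hψ0]
    simp only [map_zero]
    have : siteInner (0 : ScalarField P 0 N) (0 : ScalarField P 0 N) = 0 := by simp [siteInner]
    rw [this]; norm_num
  obtain ⟨z₀, hz₀⟩ := Finset.nonempty_iff_ne_empty.mpr hΩe
  have hδ : 0 ≤ δ := (abs_nonneg _).trans (hreg z₀ hz₀ ⟨0, P.hd⟩ ⟨0, P.hd⟩)
  -- the smallness quantities
  set ℓ : ℝ := P.d * ((P.L : ℝ) ^ k - 1) with hℓ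
  set θ' : ℝ := P.mesh 0 * |C.e| * (ℓ * (ℓ * δ)) with hθ'
  set θ'' : ℝ := P.mesh 0 * |C.e| * (ℓ * δ) with hθ''
  obtain ⟨hbud1, hbud2⟩ := budgets (P := P) (k := k) C hδ hsmall
  -- the block estimates
  have hblock : ∀ y : HiggsLattice.Site P k,
      ∑ x ∈ blockK k y, ‖ψ x‖ ^ 2
        ≤ 2 * ((P.L : ℝ) ^ (k * P.d))⁻¹ * ‖∑ x ∈ blockK k y, C.U (P.mesh 0) (multiContourSum A k x) (ψ x)‖ ^ 2
          + 2 * θ' ^ 2 * ∑ x ∈ blockK k y, ‖ψ x‖ ^ 2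
          + ((P.L : ℝ) ^ k) ^ 2 * P.mesh 0 ^ 2 / 4 *
              ∑ b : HiggsLattice.PBond P 0, (if Inside (blockK k y) b then ‖covDeriv C A ψ b‖ ^ 2 else 0)
          + ((P.L : ℝ) ^ k) ^ 2 * θ'' ^ 2 / 4 *
              ∑ b : HiggsLattice.PBond P 0, (if Inside (blockK k y) b then ‖ψ b.tgt‖ ^ 2 else 0) := by
    intro y
    by_cases hyΩ : ∃ x ∈ blockK k y, x ∈ Ω
    · obtain ⟨x₁, hx₁B, hx₁Ω⟩ := hyΩ
      have hall : ∀ x ∈ blockK k y, x ∈ Ω := fun x hx =>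
        (hΩ x x₁ (by rw [(mem_blockK k y x).mp hx, (mem_blockK k y x₁).mp hx₁B])).mpr hx₁Ω
      refine block_estimate C hk A y (fun x hx => ?_) (fun b hb => ?_) ψ
      · have h := abs_multiContourSum_sub_gaugeFn_le Ω hk hΩ A hreg (hall x hx)
        rw [abs_mul, abs_mul, abs_of_pos hm, hθ']
        exact mul_le_mul_of_nonneg_left h hme
      · have hsrcΩ : b.src ∈ Ω := hall b.src hb.1
        have h := abs_sub_refVal_le Ω hk hΩ A hreg hsrcΩ b.dir
        rw [abs_mul, abs_mul, abs_of_pos hm, hθ'', abs_sub_comm]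
        exact mul_le_mul_of_nonneg_left h hme
    · have hout : ∀ x ∈ blockK k y, x ∉ Ω := fun x hx hxΩ => hyΩ ⟨x, hx, hxΩ⟩
      have hS0 : ∑ x ∈ blockK k y, ‖ψ x‖ ^ 2 = 0 :=
        Finset.sum_eq_zero fun x hx => by rw [hψ x (hout x hx), norm_zero]; norm_num
      rw [hS0]
      have hDn : 0 ≤ ∑ b : HiggsLattice.PBond P 0, (if Inside (blockK k y) b then ‖covDeriv C A ψ b‖ ^ 2 else 0) :=
        Finset.sum_nonneg fun b _ => by split_ifs <;> positivity
      have hTn : 0 ≤ ∑ b : HiggsLattice.PBond P 0, (if Inside (blockK k y) b then ‖ψ b.tgt‖ ^ 2 else 0) :=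
        Finset.sum_nonneg fun b _ => by split_ifs <;> positivity
      positivity
  have hsum := summed_estimate C Ω hΩ A ψ hψ hblock
  have hP0 : 0 ≤ siteInner ψ (projPk C A k ψ) := siteInner_projPk_nonneg C A k ψ
  have hL0 : 0 ≤ siteInner ψ (covLaplacianN C Ω A ψ) := siteInner_covLaplacianN_nonneg C Ω A ψ
  have hψψ : 0 ≤ siteInner ψ ψ := siteInner_self_nonneg ψ
  have hM : 0 ≤ P.mesh k ^ 2 / 4 * siteInner ψ (covLaplacianN C Ω A ψ) := by positivity
  have e1 : 2 * θ' ^ 2 * siteInner ψ ψ ≤ 1 / 4 * siteInner ψ ψ := mul_le_mul_of_nonneg_right hbud1 hψψ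
  have e2 : ((P.L : ℝ) ^ k) ^ 2 * θ'' ^ 2 / 4 * P.d * siteInner ψ ψ ≤ 1 / 4 * siteInner ψ ψ :=
    mul_le_mul_of_nonneg_right hbud2 hψψ
  linarith

/-- The arithmetic of (1.8): from `‖ψ‖² ≤ 4X + (M²/2)D` with `X = ⟨ψ,P_kψ⟩ ≥ 0`, `D = ⟨ψ,−Δ_Ωψ⟩ ≥ 0`, `c = a_k ≥ 0`:
`min{2, c/4}·M⁻²‖ψ‖² ≤ cM⁻²X + D`. [cite: Balaban1983RegularityDecay, (1.8) p.573] -/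
theorem coercive_arith4 {M c X D nrm : ℝ} (hM : 0 < M) (hc : 0 ≤ c) (hX : 0 ≤ X) (hD : 0 ≤ D)
    (hψ : nrm ≤ 4 * X + M ^ 2 / 2 * D) : min 2 (c / 4) * (M⁻¹ ^ 2) * nrm ≤ c * (M⁻¹ ^ 2) * X + D := by
  have hmin1 : min 2 (c / 4) ≤ 2 := min_le_left _ _
  have hmin2 : min 2 (c / 4) ≤ c / 4 := min_le_right _ _
  have hmin0 : 0 ≤ min 2 (c / 4) := le_min (by norm_num) (by linarith)
  have hM2 : 0 < M⁻¹ ^ 2 := by positivity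
  have hMM : M⁻¹ ^ 2 * M ^ 2 = 1 := by
    rw [inv_pow, inv_mul_cancel₀ (pow_ne_zero 2 hM.ne')]
  have h1 : min 2 (c / 4) * (M⁻¹ ^ 2) * nrm ≤ min 2 (c / 4) * (M⁻¹ ^ 2) * (4 * X + M ^ 2 / 2 * D) :=
    mul_le_mul_of_nonneg_left hψ (mul_nonneg hmin0 hM2.le)
  have h2 : min 2 (c / 4) * (M⁻¹ ^ 2) * (4 * X + M ^ 2 / 2 * D)
      = 4 * min 2 (c / 4) * (M⁻¹ ^ 2) * X + min 2 (c / 4) / 2 * (M⁻¹ ^ 2 * M ^ 2) * D := by ring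
  rw [hMM, mul_one] at h2
  have h3 : 4 * min 2 (c / 4) * (M⁻¹ ^ 2) * X ≤ c * (M⁻¹ ^ 2) * X := by
    have : 4 * min 2 (c / 4) ≤ c := by linarith
    exact mul_le_mul_of_nonneg_right (mul_le_mul_of_nonneg_right this hM2.le) hX
  have h4 : min 2 (c / 4) / 2 * D ≤ D := by
    have : min 2 (c / 4) / 2 ≤ 1 := by linarith
    nlinarith
  linarith


/-- **(1.8) AT A REGULAR `A ≠ 0` FOR REGIONS, CONCRETE CARRIER** ([13] p. 573 *"there exists a positive constant γ₀ such that for e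
sufficiently small and for a regular vector field A  −Δ^{η,N}_{A,Ω} + aP_k(A) ≧ γ₀I. (1.8) The constant γ₀ is independent of the
lattice spacing η, as well as of Ω and of A"*, in the `ε`-units of [B1] (2.20) and with the mass term kept): for `Ω ⊂ T_ε` ANY union of
`k`-fold blocks (`k ≤ K`), any `m² ∈ ℝ`, `a_k ≥ 0`, EVERY vector field `A` whose one-step differences are `≤ δ` at the sites of `Ω` with
`d²·ε|e|·L^{2k}·δ ≤ 1/3`, and every field `ψ` supported in `Ω`:
`(min{2, a_k/4}(L^kε)^{−2} + m²)‖ψ‖² ≤ ⟨ψ, (−Δ^{ε,N}_{A,Ω} + m² + a_k(L^kε)^{−2}P_k(A))ψ⟩`. [cite: Balaban1983RegularityDecay, (1.8) p.573] -/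
theorem coercive_covOpK_regular_region (hk : k ≤ P.K) (Ω : Finset (HiggsLattice.Site P 0))
    (hΩ : ∀ x x' : HiggsLattice.Site P 0, blockIter k x = blockIter k x' → (x ∈ Ω ↔ x' ∈ Ω))
    (A : HiggsLattice.VecField P 0) {δ : ℝ}
    (hreg : ∀ z ∈ Ω, ∀ μ ν : Fin P.d, |A ⟨z.shift ν, μ⟩ - A ⟨z, μ⟩| ≤ δ)
    (hsmall : (P.d : ℝ) ^ 2 * (P.mesh 0 * |C.e|) * ((P.L : ℝ) ^ k) ^ 2 * δ ≤ 1 / 3)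
    (hak : 0 ≤ B1.aSeq a P.L k) (ψ : ScalarField P 0 N) (hψ : ∀ x, x ∉ Ω → ψ x = 0) :
    (min 2 (B1.aSeq a P.L k / 4) * ((P.mesh k)⁻¹ ^ 2) + msq) * siteInner ψ ψ
      ≤ siteInner ψ (covOpK C Ω A msq a k ψ) := by
  have hP := siteInner_self_le_projPk_add_cov C hk Ω hΩ A hreg hsmall ψ hψ
  have hH : siteInner ψ (covOpK C Ω A msq a k ψ)
      = siteInner ψ (covLaplacianN C Ω A ψ) + msq * siteInner ψ ψ
        + B1.aSeq a P.L k * ((P.mesh k)⁻¹ ^ 2) * siteInner ψ (projPk C A k ψ) := by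
    rw [covOpK, LinearMap.add_apply, LinearMap.add_apply, LinearMap.smul_apply, LinearMap.smul_apply,
      LinearMap.id_apply, siteInner_add_right, siteInner_add_right, siteInner_smul_right, siteInner_smul_right]
  have hX := siteInner_projPk_nonneg C A k ψ
  have hD := siteInner_covLaplacianN_nonneg C Ω A ψ
  have hM : 0 < P.mesh k := P.mesh_pos k
  have key := coercive_arith4 hM hak hX hD hP
  rw [hH, add_mul]
  linarith

/-- **(1.8) AT A REGULAR `A` FOR REGIONS, THE PRINTED (MASSLESS) SHAPE in `ε`-units**: `min{2, a_k/4}(L^kε)^{−2}‖ψ‖² ≤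
⟨ψ, (−Δ^{ε,N}_{A,Ω} + a_k(L^kε)^{−2}P_k(A))ψ⟩` for every union of `k`-fold blocks `Ω ⊂ T_ε` (`k ≤ K`, `a_k ≥ 0`), every `A` regular on
`Ω` with `d²·ε|e|·L^{2k}·δ ≤ 1/3`, and every `ψ` supported in `Ω`. [cite: Balaban1983RegularityDecay, (1.8) p.573] -/
theorem ineq18_regular_region (hk : k ≤ P.K) (Ω : Finset (HiggsLattice.Site P 0))
    (hΩ : ∀ x x' : HiggsLattice.Site P 0, blockIter k x = blockIter k x' → (x ∈ Ω ↔ x' ∈ Ω))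
    (A : HiggsLattice.VecField P 0) {δ : ℝ}
    (hreg : ∀ z ∈ Ω, ∀ μ ν : Fin P.d, |A ⟨z.shift ν, μ⟩ - A ⟨z, μ⟩| ≤ δ)
    (hsmall : (P.d : ℝ) ^ 2 * (P.mesh 0 * |C.e|) * ((P.L : ℝ) ^ k) ^ 2 * δ ≤ 1 / 3)
    (hak : 0 ≤ B1.aSeq a P.L k) (ψ : ScalarField P 0 N) (hψ : ∀ x, x ∉ Ω → ψ x = 0) :
    min 2 (B1.aSeq a P.L k / 4) * ((P.mesh k)⁻¹ ^ 2) * siteInner ψ ψ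
      ≤ siteInner ψ (covOpK C Ω A 0 a k ψ) := by
  have h := coercive_covOpK_regular_region C (msq := 0) hk Ω hΩ A hreg hsmall hak ψ hψ
  rwa [add_zero] at h

/-- **(1.8) at a regular `A` for regions, ONE CONSTANT FOR ALL `1 ≤ k ≤ K`**: with `a_k > a_∞ = a(1 − L^{−2})` ((2.15)),
`(min{2, a(1 − L^{−2})/4}(L^kε)^{−2} + m²)‖ψ‖² ≤ ⟨ψ, (−Δ^{ε,N}_{A,Ω} + m² + a_k(L^kε)^{−2}P_k(A))ψ⟩` for every union of `k`-fold blocks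
`Ω ⊂ T_ε`, every `A` regular on `Ω` with `d²·ε|e|·L^{2k}·δ ≤ 1/3` and every `ψ` supported in `Ω` (`a > 0`, `L > 1`, any `m²`) — «γ₀ independent
of the lattice spacing η, as well as of Ω and of A». [cite: Balaban1983RegularityDecay, (1.8) p.573] -/
theorem coercive_covOpK_regular_region_uniform (ha : 0 < a) (hL : 1 < P.L) (hk1 : 1 ≤ k) (hk : k ≤ P.K)
    (Ω : Finset (HiggsLattice.Site P 0))
    (hΩ : ∀ x x' : HiggsLattice.Site P 0, blockIter k x = blockIter k x' → (x ∈ Ω ↔ x' ∈ Ω))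
    (A : HiggsLattice.VecField P 0) {δ : ℝ}
    (hreg : ∀ z ∈ Ω, ∀ μ ν : Fin P.d, |A ⟨z.shift ν, μ⟩ - A ⟨z, μ⟩| ≤ δ)
    (hsmall : (P.d : ℝ) ^ 2 * (P.mesh 0 * |C.e|) * ((P.L : ℝ) ^ k) ^ 2 * δ ≤ 1 / 3)
    (ψ : ScalarField P 0 N) (hψ : ∀ x, x ∉ Ω → ψ x = 0) :
    (min 2 (a * (1 - ((P.L : ℝ) ^ 2)⁻¹) / 4) * ((P.mesh k)⁻¹ ^ 2) + msq) * siteInner ψ ψ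
      ≤ siteInner ψ (covOpK C Ω A msq a k ψ) := by
  have hL' : (1 : ℝ) < (P.L : ℝ) := by exact_mod_cast hL
  have hlt := B1.ainf_lt_aSeq ha hL' k hk1
  have hak : 0 ≤ B1.aSeq a P.L k := (B1.aSeq_pos ha hL' hk1).le
  have h := coercive_covOpK_regular_region C (msq := msq) hk Ω hΩ A hreg hsmall hak ψ hψ
  have hmin : min 2 (a * (1 - ((P.L : ℝ) ^ 2)⁻¹) / 4) ≤ min 2 (B1.aSeq a P.L k / 4) :=
    min_le_min_left 2 (by linarith)
  have hnn : 0 ≤ (P.mesh k)⁻¹ ^ 2 * siteInner ψ ψ := mul_nonneg (sq_nonneg _) (siteInner_self_nonneg ψ)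
  nlinarith

/-- The uniform constant `min{2, a(1 − L^{−2})/4}` is positive (`a > 0`, `L > 1`). [cite: Balaban1983RegularityDecay, (1.8) p.573] -/
theorem gammaReg_pos (ha : 0 < a) (hL : 1 < P.L) : 0 < min 2 (a * (1 - ((P.L : ℝ) ^ 2)⁻¹) / 4) := by
  have hL' : (1 : ℝ) < (P.L : ℝ) := by exact_mod_cast hL
  have h1 : ((P.L : ℝ) ^ 2)⁻¹ < 1 := inv_lt_one_of_one_lt₀ (by nlinarith)
  exact lt_min (by norm_num) (by nlinarith [mul_pos ha (show (0:ℝ) < 1 - ((P.L : ℝ) ^ 2)⁻¹ by linarith)])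

/-- **(1.8) at a regular `A` on the whole torus** (`Ω = T_ε`: every field is supported in `Ω`), `1 ≤ k ≤ K`, `A` regular everywhere with
`d²·ε|e|·L^{2k}·δ ≤ 1/3`: the same constant. [cite: Balaban1983RegularityDecay, (1.8) p.573] -/
theorem coercive_covOpK_regular_univ (ha : 0 < a) (hL : 1 < P.L) (hk1 : 1 ≤ k) (hk : k ≤ P.K) (msq : ℝ)
    (A : HiggsLattice.VecField P 0) {δ : ℝ}
    (hreg : ∀ (z : HiggsLattice.Site P 0) (μ ν : Fin P.d), |A ⟨z.shift ν, μ⟩ - A ⟨z, μ⟩| ≤ δ)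
    (hsmall : (P.d : ℝ) ^ 2 * (P.mesh 0 * |C.e|) * ((P.L : ℝ) ^ k) ^ 2 * δ ≤ 1 / 3) (ψ : ScalarField P 0 N) :
    (min 2 (a * (1 - ((P.L : ℝ) ^ 2)⁻¹) / 4) * ((P.mesh k)⁻¹ ^ 2) + msq) * siteInner ψ ψ
      ≤ siteInner ψ (covOpK C Finset.univ A msq a k ψ) :=
  coercive_covOpK_regular_region_uniform C ha hL hk1 hk Finset.univ (fun _ _ _ => by simp) A
    (fun z _ μ ν => hreg z μ ν) hsmall ψ (fun x hx => absurd (Finset.mem_univ x) hx)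

end Coercive

/-! ## §6 The printed (2.23) currency: «for e(L^kε) sufficiently small» -/

section Printed

variable (C : ChargeData N) {a : ℝ}

/-- **(1.8) AT A (2.23)-REGULAR `A` FOR REGIONS, IN THE RESCALED CURRENCY OF [B1] (2.23)** (the bond-by-bond form of p35's
`B1Ineq225RegularTorus`: `(L^kε|e|/e_k)·|A_μ(z + εe_ν) − A_μ(z)| ≦ c·e_k^{β−1}/L^k` at the sites `z ∈ Ω`, `e_k > 0` the effective coupling
`e(L^kε)`): whenever `d²·c·e_k^β ≦ 1/3` — *"for e(L^kε) sufficiently small"* — every union `Ω` of `k`-fold blocks (`1 ≦ k ≦ K`), every `m²`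
and every `ψ` supported in `Ω` satisfy `(min{2, a(1 − L^{−2})/4}(L^kε)^{−2} + m²)‖ψ‖² ≦ ⟨ψ, (−Δ^{ε,N}_{A,Ω} + m² + a_k(L^kε)^{−2}P_k(A))ψ⟩`
(`a > 0`, `L > 1`, any `c`; the charge `e` is arbitrary, `e = 0` included). [cite: Balaban1982Higgs1, Prop. 2.1 (2.23) p.610; Prop. 2.3 (2.33) p.611]
[cite: Balaban1983RegularityDecay, (1.8) p.573] -/
theorem coercive_covOpK_of_reg223 (ha : 0 < a) (hL : 1 < P.L) (hk1 : 1 ≤ k) (hk : k ≤ P.K)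
    (Ω : Finset (HiggsLattice.Site P 0))
    (hΩ : ∀ x x' : HiggsLattice.Site P 0, blockIter k x = blockIter k x' → (x ∈ Ω ↔ x' ∈ Ω))
    (A : HiggsLattice.VecField P 0) {creg β ec : ℝ} (hec : 0 < ec)
    (hreg : ∀ z ∈ Ω, ∀ μ ν : Fin P.d,
      P.mesh k * |C.e| / ec * |A ⟨z.shift ν, μ⟩ - A ⟨z, μ⟩| ≤ creg * ec ^ (β - 1) / (P.L : ℝ) ^ k)
    (hsmall : (P.d : ℝ) ^ 2 * creg * ec ^ β ≤ 1 / 3) (msq : ℝ)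
    (ψ : ScalarField P 0 N) (hψ : ∀ x, x ∉ Ω → ψ x = 0) :
    (min 2 (a * (1 - ((P.L : ℝ) ^ 2)⁻¹) / 4) * ((P.mesh k)⁻¹ ^ 2) + msq) * siteInner ψ ψ
      ≤ siteInner ψ (covOpK C Ω A msq a k ψ) := by
  classical
  have hm : 0 < P.mesh 0 := P.mesh_pos 0
  have hmk : 0 < P.mesh k := P.mesh_pos k
  have hLk : (0 : ℝ) < (P.L : ℝ) ^ k := pow_pos (by exact_mod_cast P.hL) k
  have hmesh : P.mesh k = (P.L : ℝ) ^ k * P.mesh 0 := mesh_eq k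
  by_cases he : C.e = 0
  · -- e = 0: the smallness is free; take δ = the sum of all differences on Ω
    set δ : ℝ := ∑ z ∈ Ω, ∑ μ : Fin P.d, ∑ ν : Fin P.d, |A ⟨z.shift ν, μ⟩ - A ⟨z, μ⟩| with hδ
    refine coercive_covOpK_regular_region_uniform C ha hL hk1 hk Ω hΩ A (δ := δ) ?_ ?_ ψ hψ
    · intro z hz μ ν
      rw [hδ]
      refine le_trans ?_ (Finset.single_le_sum (f := fun z' => ∑ μ' : Fin P.d, ∑ ν' : Fin P.d,
        |A ⟨HiggsLattice.Site.shift z' ν', μ'⟩ - A ⟨z', μ'⟩|)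
        (fun z' _ => Finset.sum_nonneg fun _ _ => Finset.sum_nonneg fun _ _ => abs_nonneg _) hz)
      refine le_trans ?_ (Finset.single_le_sum (f := fun μ' : Fin P.d => ∑ ν' : Fin P.d,
        |A ⟨HiggsLattice.Site.shift z ν', μ'⟩ - A ⟨z, μ'⟩|)
        (fun _ _ => Finset.sum_nonneg fun _ _ => abs_nonneg _) (Finset.mem_univ μ))
      exact Finset.single_le_sum (f := fun ν' : Fin P.d => |A ⟨HiggsLattice.Site.shift z ν', μ⟩ - A ⟨z, μ⟩|)
        (fun _ _ => abs_nonneg _) (Finset.mem_univ ν)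
    · rw [he, abs_zero, mul_zero]
      norm_num
  · -- e ≠ 0: δ = c·e_k^β/(L^k·L^kε·|e|), and d²·ε|e|·L^{2k}·δ = d²·c·e_k^β
    have hepos : 0 < |C.e| := abs_pos.mpr he
    set δ : ℝ := creg * ec ^ β / ((P.L : ℝ) ^ k * (P.mesh k * |C.e|)) with hδ
    have hden : 0 < (P.L : ℝ) ^ k * (P.mesh k * |C.e|) := by positivity
    refine coercive_covOpK_regular_region_uniform C ha hL hk1 hk Ω hΩ A (δ := δ) ?_ ?_ ψ hψ
    · intro z hz μ ν
      have h := hreg z hz μ ν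
      have hpow : ec ^ (β - 1) * ec = ec ^ β := by
        rw [Real.rpow_sub_one hec.ne', div_mul_cancel₀ _ hec.ne']
      -- |ΔA| ≤ (c e_k^{β−1}/L^k)·(e_k/(L^kε|e|))
      have hcoef : 0 < P.mesh k * |C.e| / ec := by positivity
      have h1 : |A ⟨z.shift ν, μ⟩ - A ⟨z, μ⟩| ≤ (creg * ec ^ (β - 1) / (P.L : ℝ) ^ k) / (P.mesh k * |C.e| / ec) := by
        rw [le_div_iff₀ hcoef, mul_comm]; exact h
      rw [hδ]
      refine h1.trans (le_of_eq ?_)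
      rw [← hpow]
      field_simp
    · rw [hδ, hmesh]
      have e : (P.d : ℝ) ^ 2 * (P.mesh 0 * |C.e|) * ((P.L : ℝ) ^ k) ^ 2 *
          (creg * ec ^ β / ((P.L : ℝ) ^ k * ((P.L : ℝ) ^ k * P.mesh 0 * |C.e|)))
          = (P.d : ℝ) ^ 2 * creg * ec ^ β := by
        field_simp
      rw [e]
      exact hsmall

end Printed

end Literature.MathematicalPhysics.QuantumFieldTheory.Balaban1983to89.B1Ineq18RegularRegion

end
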